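import Summits.ABC.IUTFork.Conditional.WRowHexLamSevenWholeLe24
import Summits.ABC.IUTFork.Conditional.WRowHexLamSevenTwoAllLevels
import Summits.ABC.IUTFork.Conditional.WRowHexLamSevenThreeAllLevels
import Summits.ABC.IUTFork.Conditional.WRowHexLamSevenFourAllLevels
import Summits.ABC.IUTFork.Conditional.WRowHexLamSevenFiveAllLevels
import Summits.ABC.IUTFork.Conditional.WRowHexLamSevenSixAllLevels
import Summits.ABC.IUTFork.Conditional.WRowHexLamSevenSevenAllLevels
import Summits.ABC.IUTFork.Conditional.WRowHexLamSevenEightAllLevels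
import Summits.ABC.IUTFork.Conditional.WRowHexLamSevenNineAllLevels
import Summits.ABC.IUTFork.Conditional.WRowHexLamSevenTenAllLevels
import Summits.ABC.IUTFork.Conditional.WRowHexLamSevenElevenAllLevels
import Summits.ABC.IUTFork.Conditional.WRowHexLamSevenTwelveAllLevels
import Summits.ABC.IUTFork.Conditional.WRowHexLamSevenThirteenAllLevels
import Summits.ABC.IUTFork.Conditional.WRowHexLamSevenFourteenAllLevels
import Summits.ABC.IUTFork.Conditional.WRowHexLamSevenFifteenAllLevels
import Summits.ABC.IUTFork.Conditional.WRowHexLamSevenSixteenAllLevels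
import Summits.ABC.IUTFork.Conditional.WRowHexLamSevenSeventeenAllLevels
import Summits.ABC.IUTFork.Conditional.WRowHexLamSevenEighteenAllLevels
import Summits.ABC.IUTFork.Conditional.WRowHexLamSevenNineteenAllLevels
import Summits.ABC.IUTFork.Conditional.WRowHexLamSevenTwentyAllLevels
import Summits.ABC.IUTFork.Conditional.WRowHexLamSevenTwentyOneAllLevels
import Summits.ABC.IUTFork.Conditional.WRowHexLamSevenTwentyTwoAllLevels
import Summits.ABC.IUTFork.Conditional.WRowHexLamSevenTwentyThreeAllLevels
import Summits.ABC.IUTFork.Conditional.WRowHexLamSevenTwentyFourAllLevels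
import Summits.ABC.IUTFork.Conditional.WRowHexLamSevenSevenFortyOne
import Summits.ABC.IUTFork.Conditional.WRowHexLamSevenTenLevel4723
import Summits.ABC.IUTFork.Conditional.WRowHexLamSevenEighteenLevel6917611
import HarnessLib

/-!
# R-W WINDOW numerics («W:HEX-UNIFORM-K», part U3 twin): «HEX WHOLE k = 1…24 UNDER ONE THEOREM NAME» — the 24 decided HEX axes
# `λ_k = 1/2 + 2/7^k`, `k = 1…24`, packaged with the `(k, L₀(k), L⁺(k))` table IN THE BINDER

PROOF-ONLY file (D-0012; 0 definitions, 0 `Prop` facts, no instance, no notation) of the abc-iut cell — branch C certificate seat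
abc-iut-C-cert-1 (gen 9), row «W:HEX-UNIFORM-K» (abc-iut-plan C-R122 (a), KEY wake/KEY-abc-iut-C-cert-1-HEXUNIFORMK.md). TAKES NO SIDE on
[IUTchIII] Cor. 3.12 (S. Mochizuki, *Inter-universal Teichmüller theory III*, Cor. 3.12 p. 173–174; Step (xi-f) p. 184) or on any author;
«refuted / inhabited as typed» ≠ «refuted / asserted in print». THIS FILE: the `«∃ ρ qK, QPinned ∧ PilotKummerCompatHull»` twin **`WRow.hex_whole_le_24_hull`** of `WRow.hex_whole_le_24` (`WRowHexLamSevenWholeLe24.lean`): same list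
literal, INHABITED side only (`L⁺ ≤ l`; any columns `col`; every pair of realising ideles) — the refuted side from `11` is in the tree only in the
K-line shape (W-neg-2's `HexRad.…_rad_eleven`, the `…_le` glue theorems), so no `¬∃`-twin from `11` is packaged here (the band files carry it from `481`).
THE TABLE (desks of record: abc-iut-W-num-5 engine C 07:20:50Z + the filing seats; FINDINGS §T.8–§T.11): `k = 1…7`: `(10, 11)` — NO refuted prime
`≥ 11` (the first conjunct is VACUOUS under `11 ≤ l`; inhabited at every prime `l ≥ 11` by abc-iut-w5-d107's `WRow.licence_lamSeven_<k>_all`, at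
`(7, 41)` by `WRow.licence_lamSeven_seven_fortyOne`) · `k = 8`: `(71, 73)` (REF = abc-iut-rh-typ-4's `HexHullThreshold.…_lamSeven_even`, tabulated primes
`11…71`) · `k = 9`: `(337, 347)` (`…_nine_le`, the HEX9-GAP file) · `k = 10`: `(4721, 4723)` — the INHABITED side STARTS AT THE CEILING-ONLY LEVEL
`4723` (abc-iut-W-neg-1's `WRow.licence_lamSeven_ten_level4723`, inner radius `⌈e/6⌉`; `…_ten_all` from `4729`) — the shape the files give, not smoothed ·
`k = 11`: `(811, 821)` (REF = W-neg-2's `HexRad.…_rad_eleven` `≤ 479` + rh-typ-4's `…_eleven_band` `481…811`) · `k = 12…17`: `(20063, 20071)`, `(5851, 5857)`,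
`(46933, 46957)`, `(617587, 617647)`, `(329269, 329281)`, `(288203, 288209)` (gen 8) · `k = 18`: `(6917593, 6917611)` — inhabited side again STARTS AT THE
CEILING-ONLY LEVEL `6917611` (W-neg-1's `WRow.licence_lamSeven_eighteen_level6917611`; `…_eighteen_all` from `6917621`) · `k = 19…24`: `(2017637, 2017643)`,
`(80707019, 80707051)`, `(42371239, 42371257)`, `(112989881, 112989913)`, `(98866283, 98866289)`, `(2372791879, 2372791903)` (gen 9). For EVERY row
no prime lies strictly between `L₀` and `L⁺` (desk; e.g. `4724…4728`, `6917594…6917610` and `6917612…6917620` are composite), so each axis is DECIDED AS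
TYPED AT EVERY PRIME `l ≥ 11` — on the refuted side in the K-line shape, on the inhabited side for every pair of realising ideles.
HONEST SCOPE: OUR sharp containers and Dupuy–Hilado's typed (Ind1)/(Ind2); the per-label licence is a STRONGER-THAN-PRINT sufficient form of
Step (xi-f); admissibility / Szpiro-badness / (P6) of `(ratPoint λ_k, l)` and NON-EMPTINESS of the datum type are NOT claimed here (see
abc-iut-w6-d102's `FreyLegendreAdmN3Hex*` / C-cert-3's NV riders for the tabulated levels); nothing about the printed inequality, the number-level
`Cor22.Cor312AtDatum` or any author's intended hull; typed ≠ proved; instantiated ≠ endorsed; no abc claim.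
[cite: Mochizuki2012, IUTchI Def. 3.1 (b),(c) pp. 61–62, Ex. 3.2 (iv) p. 71; IUTchIII Cor. 3.12 Step (xi-d) p. 183, (xi-f) p. 184; IUTchIV Prop. 1.2 (i)(ii) p. 10, Prop. 1.4 (ii) p. 13, Cor. 2.2 (ii) proof (P5) p. 46] [cite: DupuyHilado2025, §3.3, §3.4, §4.9, §4.12] [claim: Mochizuki2012, status: disputed] for every IUT sentence quoted.
-/

noncomputable section

open Set Function Metric NumberField IsDedekindDomain

namespace Summit.ABC.IUTFork.Conditional

open Thm311 Thm311.Real Cor312 Cor312Vol Cor312Prov Literature.IUT.LogThetaLattice Literature.IUT.LogVolume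
  Literature.IUT.HodgeTheaters Literature.IUT.LogVolume.Cor22
open Literature.NumberTheory.NumberFields Literature.NumberTheory.GaloisRepresentations.Ultrametric
open Literature.NumberTheory.DiophantineGeometry Literature.NumberTheory.DiophantineGeometry.GenEll

open Summit.ABC.IUTFork.Repair.RH.HullThresholdExact

/-- **The `«∃ ρ qK, QPinned ∧ PilotKummerCompatHull»` twin of `WRow.hex_whole_le_24` (inhabited side):** for every row `(k, L₀, L⁺)` of the same
24-row list literal, every prime `l` with `L⁺ ≤ l`, every genuine Θ-volume datum `T` over `(ratPoint (1/2 + 2/7^k), l)`, any columns `col` and every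
pair of realising ideles, branch C's per-datum antecedent HOLDS — by the `exists_qPinned_and_hull` theorems of the same files BY NAME
(w5-d107 / C-cert-1 `…_all`, `…_seven_fortyOne`, W-neg-1 `…_ten_level4723` / `…_eighteen_level6917611`).
[cite: Mochizuki2012, IUTchIII Cor. 3.12 Step (xi-d) p. 183, (xi-f) p. 184] [cite: DupuyHilado2025, §3.3, §3.4, §4.9] [claim: Mochizuki2012, status: disputed] -/
theorem WRow.hex_whole_le_24_hull {k L0 Lp l : ℕ}
    (hmem : (k, L0, Lp) ∈ ([(1, 10, 11), (2, 10, 11), (3, 10, 11), (4, 10, 11), (5, 10, 11), (6, 10, 11), (7, 10, 11), (8, 71, 73), (9, 337, 347), (10, 4721, 4723), (11, 811, 821), (12, 20063, 20071), (13, 5851, 5857), (14, 46933, 46957), (15, 617587, 617647), (16, 329269, 329281), (17, 288203, 288209), (18, 6917593, 6917611), (19, 2017637, 2017643), (20, 80707019, 80707051), (21, 42371239, 42371257), (22, 112989881, 112989913), (23, 98866283, 98866289), (24, 2372791879, 2372791903)] : List (ℕ × ℕ × ℕ)))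
    (hl : l.Prime) (hLp : Lp ≤ l) (T : Cor22.ThetaVolumeDatumAt (ratPoint ((2 : ℚ)⁻¹ + 2 / 7 ^ k)) l) :
    letI := T.instFieldF; letI := T.instNumberFieldF; letI := T.instAlgebraF; letI := T.instFieldK
    letI := T.instNumberFieldK; letI := T.instAlgebraK; letI := T.instFieldFbar; letI := T.instAlgebraFbar
    letI := T.instAlgebraKFbar; letI := T.instIsElliptic
    ∀ {logv : PadicLogs T.K} (hlog : LogvAnalytic logv) (M : Type) [Field M] [NumberField M]
      (archPk : ∀ (j : (thetaIndex (pilotDataOfK T.D T.K)).Label) (vQ : (thetaIndex (pilotDataOfK T.D T.K)).VQ),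
        Set ((logShellsDH (pilotDataOfK T.D T.K) logv).Packet j vQ))
      (archSub : ∀ (j : (thetaIndex (pilotDataOfK T.D T.K)).Label) (v : (thetaIndex (pilotDataOfK T.D T.K)).V),
        Set ((logShellsDH (pilotDataOfK T.D T.K) logv).Packet j ((thetaIndex (pilotDataOfK T.D T.K)).over v)))
      (Ψ : ℤ → ∀ v : (thetaIndex (pilotDataOfK T.D T.K)).V, v ∈ (thetaIndex (pilotDataOfK T.D T.K)).Vbad →
        Set ((logShellsDH (pilotDataOfK T.D T.K) logv).StarPacket v))
      (act : ℤ → ∀ v : (thetaIndex (pilotDataOfK T.D T.K)).V, v ∈ (thetaIndex (pilotDataOfK T.D T.K)).Vbad →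
        (logShellsDH (pilotDataOfK T.D T.K) logv).StarPacket v → Module.End ℚ ((logShellsDH (pilotDataOfK T.D T.K) logv).StarPacket v))
      (Mmod : ℤ → ∀ j : (thetaIndex (pilotDataOfK T.D T.K)).LabelStar, Set ((logShellsDH (pilotDataOfK T.D T.K) logv).GlobalPacket j.1))
      (region : ℤ → ∀ j : (thetaIndex (pilotDataOfK T.D T.K)).LabelStar, FinDivisor M → ∀ vQ : (thetaIndex (pilotDataOfK T.D T.K)).VQ,
        Set ((logShellsDH (pilotDataOfK T.D T.K) logv).Packet j.1 vQ))
      (n : ℤ) {HT : Type} {LogLink : HT → HT → Type} {IsFull : ∀ {s t : HT}, LogLink s t → Prop}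
      (lat : LGPGaussianLogThetaLattice LogLink IsFull)
      {Frd : Type} {IsoF : Frd → Frd → Type} {Ob : Frd → Type} {realify : Frd → Frd} {Strip : Type}
      {IsoS : Strip → Strip → Type} {Mv : ∀ v : (thetaIndex (pilotDataOfK T.D T.K)).V, v ∈ (thetaIndex (pilotDataOfK T.D T.K)).Vbad → Type}
      [∀ v h, Monoid (Mv v h)]
      (sig : GlobalLGPFrobenioidSignature (thetaIndex (pilotDataOfK T.D T.K)).lstar (thetaIndex (pilotDataOfK T.D T.K)).V
        (· ∈ (thetaIndex (pilotDataOfK T.D T.K)).Vbad) Frd IsoF Ob realify Strip IsoS Mv)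
      (split : SplittingMonoids Mv) {ObΔ : Type} {N : ∀ v : (thetaIndex (pilotDataOfK T.D T.K)).V, v ∈ (thetaIndex (pilotDataOfK T.D T.K)).Vbad → Type}
      [∀ v h, Monoid (N v h)] (qData : QPilotData ObΔ N)
      (tq : ∀ (pp : Nat.Primes) (x : (thetaIndex (pilotDataOfK T.D T.K)).Fibre (.inr pp)),
        haveI : Fact (pp : ℕ).Prime := ⟨pp.2⟩; kOf (pilotDataOfK T.D T.K) pp.1 x)
      (t : ∀ (pp : Nat.Primes) (_ : Fin (pilotDataOfK T.D T.K).lstar) (x : (thetaIndex (pilotDataOfK T.D T.K)).Fibre (.inr pp)),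
        haveI : Fact (pp : ℕ).Prime := ⟨pp.2⟩; kOf (pilotDataOfK T.D T.K) pp.1 x)
      (htq0 : ∀ pp x, tq pp x ≠ 0)
      (htq1 : ∀ (pp : Nat.Primes) (x : (thetaIndex (pilotDataOfK T.D T.K)).Fibre (.inr pp)),
        haveI : Fact (pp : ℕ).Prime := ⟨pp.2⟩; placeOf (pilotDataOfK T.D T.K) pp.1 x ∉ (pilotDataOfK T.D T.K).S → ‖tq pp x‖ = 1)
      (col : ℤ → Column (logShellsDH (pilotDataOfK T.D T.K) logv))
      (_ht0 : ∀ pp i x, t pp i x ≠ 0)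
      (_ht : ∀ (pp : Nat.Primes) (i : Fin (pilotDataOfK T.D T.K).lstar) (x : (thetaIndex (pilotDataOfK T.D T.K)).Fibre (.inr pp)),
        haveI : Fact (pp : ℕ).Prime := ⟨pp.2⟩
        Real.log ‖t pp i x‖ = -((pilotDataOfK T.D T.K).thetaPilot i (placeOf (pilotDataOfK T.D T.K) pp.1 x)) *
          logNorm T.K (placeOf (pilotDataOfK T.D T.K) pp.1 x) / localDegree T.K (placeOf (pilotDataOfK T.D T.K) pp.1 x))
      (_htq : ∀ (pp : Nat.Primes) (x : (thetaIndex (pilotDataOfK T.D T.K)).Fibre (.inr pp)),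
        haveI : Fact (pp : ℕ).Prime := ⟨pp.2⟩
        Real.log ‖tq pp x‖ = -((pilotDataOfK T.D T.K).qPilot (placeOf (pilotDataOfK T.D T.K) pp.1 x)) *
          logNorm T.K (placeOf (pilotDataOfK T.D T.K) pp.1 x) / localDegree T.K (placeOf (pilotDataOfK T.D T.K) pp.1 x)),
      ∃ (ρ : (∀ v : (thetaIndex (pilotDataOfK T.D T.K)).V, v ∈ (thetaIndex (pilotDataOfK T.D T.K)).Vbad →
              Set ((logShellsDH (pilotDataOfK T.D T.K) logv).StarPacket v)) →
            ∀ (j : (thetaIndex (pilotDataOfK T.D T.K)).Label) (vQ : (thetaIndex (pilotDataOfK T.D T.K)).VQ),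
              Set ((logShellsDH (pilotDataOfK T.D T.K) logv).Packet j vQ))
          (qK : ∀ v : (thetaIndex (pilotDataOfK T.D T.K)).V, v ∈ (thetaIndex (pilotDataOfK T.D T.K)).Vbad →
            Set ((logShellsDH (pilotDataOfK T.D T.K) logv).StarPacket v)),
          QPinned ({ toSituation := situationPrVol (pilotDataOfK T.D T.K) hlog M archPk archSub Ψ act Mmod region, col := col } :
              LatticeSituation (thetaIndex (pilotDataOfK T.D T.K)))
            (settingPrVolSharp (pilotDataOfK T.D T.K) hlog M archPk archSub Ψ act Mmod region n lat sig split qData tq t htq0 htq1) ρ qK ∧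
          PilotKummerCompatHull ({ toSituation := situationPrVol (pilotDataOfK T.D T.K) hlog M archPk archSub Ψ act Mmod region, col := col } :
              LatticeSituation (thetaIndex (pilotDataOfK T.D T.K)))
            (settingPrVolSharp (pilotDataOfK T.D T.K) hlog M archPk archSub Ψ act Mmod region n lat sig split qData tq t htq0 htq1) ρ qK := by
  simp only [List.mem_cons, Prod.mk.injEq, List.not_mem_nil, or_false] at hmem
  rcases hmem with ⟨rfl, rfl, rfl⟩ | ⟨rfl, rfl, rfl⟩ | ⟨rfl, rfl, rfl⟩ | ⟨rfl, rfl, rfl⟩ | ⟨rfl, rfl, rfl⟩ | ⟨rfl, rfl, rfl⟩ | ⟨rfl, rfl, rfl⟩ | ⟨rfl, rfl, rfl⟩ | ⟨rfl, rfl, rfl⟩ | ⟨rfl, rfl, rfl⟩ | ⟨rfl, rfl, rfl⟩ | ⟨rfl, rfl, rfl⟩ | ⟨rfl, rfl, rfl⟩ | ⟨rfl, rfl, rfl⟩ | ⟨rfl, rfl, rfl⟩ | ⟨rfl, rfl, rfl⟩ | ⟨rfl, rfl, rfl⟩ | ⟨rfl, rfl, rfl⟩ | ⟨rfl, rfl,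 rfl⟩ | ⟨rfl, rfl, rfl⟩ | ⟨rfl, rfl, rfl⟩ | ⟨rfl, rfl, rfl⟩ | ⟨rfl, rfl, rfl⟩ | ⟨rfl, rfl, rfl⟩
  · -- k = 1: L⁺ = 11
    exact WRow.exists_qPinned_and_hull_lamSeven_one_all rfl hl hLp T
  · -- k = 2: L⁺ = 11
    exact WRow.exists_qPinned_and_hull_lamSeven_two_all rfl hl hLp T
  · -- k = 3: L⁺ = 11
    exact WRow.exists_qPinned_and_hull_lamSeven_three_all rfl hl hLp T
  · -- k = 4: L⁺ = 11
    exact WRow.exists_qPinned_and_hull_lamSeven_four_all rfl hl hLp T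
  · -- k = 5: L⁺ = 11
    exact WRow.exists_qPinned_and_hull_lamSeven_five_all rfl hl hLp T
  · -- k = 6: L⁺ = 11
    exact WRow.exists_qPinned_and_hull_lamSeven_six_all rfl hl hLp T
  · -- k = 7: L⁺ = 11
    by_cases h41 : l = 41
    · exact WRow.exists_qPinned_and_hull_lamSeven_seven_fortyOne rfl h41 T
    · exact WRow.exists_qPinned_and_hull_lamSeven_seven_all rfl hl hLp h41 T
  · -- k = 8: L⁺ = 73
    exact WRow.exists_qPinned_and_hull_lamSeven_eight_all rfl hl hLp T
  · -- k = 9: L⁺ = 347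
    exact WRow.exists_qPinned_and_hull_lamSeven_nine_all rfl hl hLp T
  · -- k = 10: L⁺ = 4723
    by_cases hlv : l = 4723
    · exact WRow.exists_qPinned_and_hull_lamSeven_ten_level4723 rfl hlv T
    · rcases Nat.lt_or_ge l 4729 with hlt | hge
      · exfalso
        interval_cases l <;> first | exact hlv rfl | exact absurd hl (by norm_num)
      · exact WRow.exists_qPinned_and_hull_lamSeven_ten_all rfl hl hge T
  · -- k = 11: L⁺ = 821
    exact WRow.exists_qPinned_and_hull_lamSeven_eleven_all rfl hl hLp T
  · -- k = 12: L⁺ = 20071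
    exact WRow.exists_qPinned_and_hull_lamSeven_twelve_all rfl hl hLp T
  · -- k = 13: L⁺ = 5857
    exact WRow.exists_qPinned_and_hull_lamSeven_thirteen_all rfl hl hLp T
  · -- k = 14: L⁺ = 46957
    exact WRow.exists_qPinned_and_hull_lamSeven_fourteen_all rfl hl hLp T
  · -- k = 15: L⁺ = 617647
    exact WRow.exists_qPinned_and_hull_lamSeven_fifteen_all rfl hl hLp T
  · -- k = 16: L⁺ = 329281
    exact WRow.exists_qPinned_and_hull_lamSeven_sixteen_all rfl hl hLp T
  · -- k = 17: L⁺ = 288209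
    exact WRow.exists_qPinned_and_hull_lamSeven_seventeen_all rfl hl hLp T
  · -- k = 18: L⁺ = 6917611
    by_cases hlv : l = 6917611
    · exact WRow.exists_qPinned_and_hull_lamSeven_eighteen_level6917611 rfl hlv T
    · rcases Nat.lt_or_ge l 6917621 with hlt | hge
      · exfalso
        interval_cases l <;> first | exact hlv rfl | exact absurd hl (by norm_num)
      · exact WRow.exists_qPinned_and_hull_lamSeven_eighteen_all rfl hl hge T
  · -- k = 19: L⁺ = 2017643
    exact WRow.exists_qPinned_and_hull_lamSeven_nineteen_all rfl hl hLp T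
  · -- k = 20: L⁺ = 80707051
    exact WRow.exists_qPinned_and_hull_lamSeven_twenty_all rfl hl hLp T
  · -- k = 21: L⁺ = 42371257
    exact WRow.exists_qPinned_and_hull_lamSeven_twentyOne_all rfl hl hLp T
  · -- k = 22: L⁺ = 112989913
    exact WRow.exists_qPinned_and_hull_lamSeven_twentyTwo_all rfl hl hLp T
  · -- k = 23: L⁺ = 98866289
    exact WRow.exists_qPinned_and_hull_lamSeven_twentyThree_all rfl hl hLp T
  · -- k = 24: L⁺ = 2372791903
    exact WRow.exists_qPinned_and_hull_lamSeven_twentyFour_all rfl hl hLp T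

end Summit.ABC.IUTFork.Conditional

end
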